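import Summits.Langlands.Langlands.Theorems.IrreducibilityBySelfDualityReciprocityUpToIrreducibilityAboveUnramified
import Literature.NumberTheory.Automorphic.LocalLanglandsGLOne
import HarnessLib

/-!
# Line `Sketch` for the crux `ReciprocityUpToIrreducibility` (item stmt-Langlands-14328), continuation c4:
# the rank-one matching `rec₁[χ ∘ det] = [(r.ρ, 0)]` for an unramified quasi-character

Support file (closes nothing; registered stub `stub_rankOne_unramified_recGL_matching` of line
`Sketch`, continuation lead c4, prover-line-stmt-Langlands-14328-c4-0).

With c3's `localGlobalCompatibleAt_above_iff_of_isUnramifiedAt` (and its `v ∤ ℓ` analogue) the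
summit's local–global compatibility on the unramified-at-`v` sector is ONE `ℓ`-blind matching
`rℂ.HasFrobSemisimpleClass ((Rec.llc v).recGL n [π_v])` for a transport `rℂ` of `(ρ|_{W_{K_v}}, 0)`.
This file settles the LOCAL rank-one case of that matching, for EVERY local Langlands datum `L` of a
non-archimedean local field `F`:

* `quasiChar_artin_eq_one_of_mem_inertia` — an unramified quasi-character `χ` (trivial on `𝒪_Fˣ`)
  kills `artin(I_F)`, because `artin(I_F) = 𝒪_Fˣ` (`LocalArtinData.image_inertia`).
* `eq_ofQuasiCharOn_of_isUnramifiedRep` — **rigidity**: a Weil–Deligne representation `r` on any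
  complex space `V` with `N = 0`, `r.ρ` trivial on inertia and `r.ρ(Φ) = χ(artin Φ) • id` for ONE
  geometric Frobenius `Φ` IS `(χ ∘ artin acting by scalars, 0) = ofQuasiCharOn V hns d χ`: the two
  homomorphisms `r.ρ`, `χ ∘ artin • id : W_F →* End(V)` agree on `I_F` and at `Φ`, hence everywhere
  (`WeilGroup.intertwines_of_inertia_of_frob` with `A = 1`: `W_F = ⟨Φ, I_F⟩`).
* `hasFrobSemisimpleClass_recGL_one_of_isUnramifiedRep` — on `V = ℂ¹ = Fin 1 → ℂ` such an `r` is
  the representative `ofQuasiCharOn (Fin 1 → ℂ) L.hns L.artin χ` of the class `L.recGL 1 [χ ∘ det]`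
  (`IsLocalLanglandsGL.rec_one_mk`: every local Langlands correspondence is local class field
  theory in degree one), and it is Frobenius-semisimple, so it has that class.
* `stub_rankOne_unramified_recGL_matching` — the registered stub (closed form).

No definitions; standard axioms only.
-/

noncomputable section

set_option linter.dupNamespace false -- project-wide option (lakefile weak.linter.dupNamespace); `Summit.Langlands.Langlands` is the mandated namespace

open scoped MatrixGroups Matrix NumberField Classical Polynomial
open Filter IsDedekindDomain Field Polynomial
open Literature.NumberTheory.Automorphic Literature.NumberTheory.GaloisRepresentations
open Literature.NumberTheory.PAdicHodge
open Summit.Langlands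

namespace Summit.Langlands.Langlands.Theorems.ReciprocityUpToIrreducibility

section Local

variable {F : Type} [Field F] [ValuativeRel F] [TopologicalSpace F] [IsNonarchimedeanLocalField F]

/-- **An unramified quasi-character kills `artin(I_F)`.**  If `χ : Fˣ → ℂˣ` is trivial on the unit
group `𝒪_Fˣ` then `χ(artin u) = 1` for every `u` in the inertia group, since a local Artin datum maps
`I_F` onto `𝒪_Fˣ` (`LocalArtinData.image_inertia`). [cite: TateCorvallis1979, (1.4.1)–(1.4.6)] -/
theorem quasiChar_artin_eq_one_of_mem_inertia (d : LocalArtinData F) {χ : QuasiChar F}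
    (hχ : ∀ u : Fˣ, u ∈ (ValuativeRel.valuation F).valuationSubring.unitGroup → χ u = 1)
    {u : WeilGroup F} (hu : u ∈ WeilGroup.inertia F) : χ (d.artin u) = 1 := by
  refine hχ _ ?_
  rw [← d.image_inertia]
  exact Subgroup.mem_map_of_mem d.artin hu

/-- **Rigidity of unramified characters of `W_F`.**  Let `χ` be a quasi-character of `Fˣ` trivial on
`𝒪_Fˣ`, `d` a local Artin datum and `r` a Weil–Deligne representation on a complex space `V` with
`N = 0`, `r.ρ` trivial on the inertia group and `r.ρ(Φ) = χ(artin Φ) • id` for one geometric Frobenius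
`Φ` (`deg Φ = -1`).  Then `r = (χ ∘ artin • id, 0) = ofQuasiCharOn V hns d χ`: both `r.ρ` and
`w ↦ χ(artin w) • id` are homomorphisms `W_F →* End(V)` trivial on `I_F` (`artin(I_F) = 𝒪_Fˣ`) and
equal at `Φ`, and `W_F` is generated by `I_F` and `Φ` (`WeilGroup.intertwines_of_inertia_of_frob`).
[cite: TateCorvallis1979, (1.4.1) and (4.1.3)] -/
theorem eq_ofQuasiCharOn_of_isUnramifiedRep
    (hns : WeilGroup.exists_subgroup_le_inertia_isOpen_of_continuous (F := F))
    (d : LocalArtinData F) {χ : QuasiChar F}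
    (hχ : ∀ u : Fˣ, u ∈ (ValuativeRel.valuation F).valuationSubring.unitGroup → χ u = 1)
    {V : Type*} [AddCommGroup V] [Module ℂ V]
    (r : WeilDeligneRep F ℂ V) (hN : r.N = 0) (hunr : WeilGroup.IsUnramifiedRep r.ρ)
    {Φ : WeilGroup F} (hΦ : WeilGroup.deg Φ = -1)
    (hρΦ : r.ρ Φ = ((χ (d.artin Φ) : ℂˣ) : ℂ) • LinearMap.id) :
    r = WeilDeligneRep.ofQuasiCharOn V hns d χ := by
  have hρ : ∀ w, r.ρ w = (WeilDeligneRep.ofQuasiCharOn V hns d χ).ρ w := fun w => by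
    have h := WeilGroup.intertwines_of_inertia_of_frob r.ρ
      (WeilDeligneRep.ofQuasiCharOn V hns d χ).ρ 1 hΦ ?_ ?_ w
    · rwa [one_mul, mul_one] at h
    · rw [one_mul, mul_one, hρΦ]
      exact LinearMap.ext fun v => rfl
    · intro u hu
      rw [one_mul, mul_one, hunr u hu]
      refine LinearMap.ext fun v => ?_
      rw [WeilDeligneRep.ofQuasiCharOn_ρ_apply, quasiChar_artin_eq_one_of_mem_inertia d hχ hu,
        Units.val_one, one_smul]
      rfl
  cases r with
  | mk ρr hc N hnil hconj =>
    have h1 : ρr = (WeilDeligneRep.ofQuasiCharOn V hns d χ).ρ := MonoidHom.ext fun w => hρ w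
    have h2 : N = 0 := hN
    subst h1 h2
    rfl

/-- **The rank-one matching for an unramified quasi-character.**  For every local Langlands datum
`L` of `F`, an unramified quasi-character `χ` of `Fˣ` and a Weil–Deligne representation `r` on
`ℂ¹ = Fin 1 → ℂ` with `N = 0`, `r.ρ` trivial on inertia and `r.ρ(Φ) = χ(artin Φ) • id` for one
geometric Frobenius `Φ`: the Frobenius-semisimplification of `r` has class `L.recGL 1 [χ ∘ det]`.
Indeed `r = ofQuasiCharOn (Fin 1 → ℂ) L.hns L.artin χ` (`eq_ofQuasiCharOn_of_isUnramifiedRep`), which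
is Frobenius-semisimple (`isFrobSemisimple_ofQuasiCharOn`) and represents `L.recGL 1 [χ ∘ det]`
because every local Langlands correspondence is local class field theory in degree one
(`IsLocalLanglandsGL.rec_one_mk`, Harris–Taylor 2001, Thm. A (i)).
[cite: HarrisTaylorAMS2001, Thm. A (i)] [cite: TateCorvallis1979, (1.4.5) and (4.1.3)] -/
theorem hasFrobSemisimpleClass_recGL_one_of_isUnramifiedRep (L : LocalLanglandsDatum F)
    {χ : QuasiChar F}
    (hχ : ∀ u : Fˣ, u ∈ (ValuativeRel.valuation F).valuationSubring.unitGroup → χ u = 1)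
    (r : WeilDeligneRep F ℂ (Fin 1 → ℂ)) (hN : r.N = 0) (hunr : WeilGroup.IsUnramifiedRep r.ρ)
    {Φ : WeilGroup F} (hΦ : WeilGroup.deg Φ = -1)
    (hρΦ : r.ρ Φ = ((χ (L.artin.artin Φ) : ℂˣ) : ℂ) • LinearMap.id) :
    r.HasFrobSemisimpleClass (L.recGL 1 (IrrClass.mk (SmoothIrrep.ofQuasiChar χ))) := by
  rw [eq_ofQuasiCharOn_of_isUnramifiedRep L.hns L.artin hχ r hN hunr hΦ hρΦ,
    L.isLocalLanglands.rec_one_mk (SmoothIrrep.ofQuasiChar_ρ_apply χ)]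
  exact (WeilDeligneRep.isFrobSemisimple_ofQuasiCharOn L.hns L.artin χ).hasFrobSemisimpleClass

/-- **Registered stub `stub_rankOne_unramified_recGL_matching` of line `Sketch` (crux
stmt-Langlands-14328), closed form of `hasFrobSemisimpleClass_recGL_one_of_isUnramifiedRep`**: for any
local Langlands datum `L` over a local field `F`, an unramified quasi-character `χ` of `Fˣ` (trivial on
`𝒪_Fˣ`) and a Weil–Deligne representation `r` on `ℂ¹` with `N = 0`, `r.ρ` trivial on inertia and
`r.ρ(Φ) = χ(artin Φ)` for ONE geometric Frobenius `Φ`, `r` lies in the class `rec₁[χ ∘ det]`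
(`r = (χ ∘ artin, 0)` on `ℂ¹` since `W_F = Φ^ℤ · I_F` and `artin(I_F) = 𝒪_Fˣ`;
`IsLocalLanglandsGL.rec_one_mk`). [cite: HarrisTaylorAMS2001, Thm. A (i)]
[cite: TateCorvallis1979, (1.4.5)] -/
theorem stub_rankOne_unramified_recGL_matching :
    ∀ (F : Type) [Field F] [ValuativeRel F] [TopologicalSpace F] [IsNonarchimedeanLocalField F]
      (L : LocalLanglandsDatum F) (χ : QuasiChar F),
      (∀ u : Fˣ, u ∈ (ValuativeRel.valuation F).valuationSubring.unitGroup → χ u = 1) →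
      ∀ (r : WeilDeligneRep F ℂ (Fin 1 → ℂ)), r.N = 0 → WeilGroup.IsUnramifiedRep r.ρ →
      (∃ Φ : WeilGroup F, WeilGroup.deg Φ = -1 ∧
        r.ρ Φ = ((χ (L.artin.artin Φ) : ℂˣ) : ℂ) • LinearMap.id) →
      r.HasFrobSemisimpleClass (L.recGL 1 (IrrClass.mk (SmoothIrrep.ofQuasiChar χ))) :=
  fun _ _ _ _ _ L _ hχ r hN hunr ⟨_, hΦ, hρΦ⟩ =>
    hasFrobSemisimpleClass_recGL_one_of_isUnramifiedRep L hχ r hN hunr hΦ hρΦ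

end Local

end Summit.Langlands.Langlands.Theorems.ReciprocityUpToIrreducibility

end
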